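import Summits.Parity.GeneralizedHardyLittlewood.Theorems.LeeYangFibresRelativeDimOneSplitDefs
import HarnessLib

/-!
# Route `LeeYangFibres`, crux `RelativeDimOne` (stmt-Parity-14113): vocabulary of the RESHAPED line
`gallagher-backwards-split` (lead seat c1) — the TYPE-CONDITIONED split
`crux ⟸ (incidence-bandlimited core WITH Hardy–Littlewood decay) ∧ (class second moment)`

Route-posited objects (D-0016 `<Route><Crux>Defs` file). NOTHING IS ASSERTED: every `def … : Prop` below is a
statement — the type of a registered stub of the reshaped skeleton `Cruxes/RelativeDimOne/Lines/gallagher_backwards_split.lean`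
(`stub_coreDecay`, `stub_lowSecondMoment`, `stub_typeClassMoments`, `stub_typeRigidity`, `stub_singularWeights`,
`stub_typeData`, `stub_endgame`). The identity `hlCoeff_one` is PROVED and is the registered sub-goal this file lands under.

WHY A RESHAPE (evidence `StubRigidityFalse-c1.md`, crux dir, commit c03ddcce3628): the registered
`stub_rigidity : IncidenceRigidity (1/4) (3/10)` of the original split is FALSE — (F2) a product/Chebyshev incidence
spectrum with vanishing box-coset averages and an a-priori bound but `E(2) = 1`; (F1) inside the Hardy–Littlewood decay
class, the `(q/φ(q))^{t+1}` slack of the residue-coset data lets a spectrum concentrate on shifts with many small prime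
factors. Two repairs are forced and made here:
* DECAY: the core spectrum carries Hardy–Littlewood decay `|f(q, a, b)| ≤ C ∏_{p ∣ q} (|β_p(a,b) − 1| + t²/p²)` (kills F2;
  still NECESSARY for the crux: the truncated singular-series spectrum `μ²(q) ∏_{p∣q}(β_p − 1)` has it with `C = 1`);
* TYPE CELLS instead of residue cosets: the data are averages over the shifts `b` whose INCIDENCE TYPES agree with the
  target's at every prime `p ≤ w` (no residue is prescribed). This kills F1 (no slack: errors are relative to the
  cell's own local factor `∏_{p ≤ w} β_p`) and — the point — is DELIVERABLE for every `t` from the class second moment: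
  in the multilinear expansion over a type cell the one-deviation terms collapse to the GLOBAL prime number theorem
  (the completion counts are invariant under unit scaling of the cell), so no pointwise information on primes in
  progressions is ever used; two deviations cost the class variance, more cost Brun–Titchmarsh.

References: Green–Tao, Ann. of Math. 171 (2010), Conj. 1.4, (1.6) [GreenTao2010]; Gallagher, Mathematika 23 (1976) §2
[Gallagher1976].
-/

noncomputable section

open scoped BigOperators Classical
open Finset Literature.NumberTheory.Sieve
open Summit.Parity.GeneralizedHardyLittlewood.Theses.LeeYangFibres (RelativeDimOne)
open Summit.Parity.GeneralizedHardyLittlewood.Cruxes.RelativeDimOne.GallagherBackwards (classPsi)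
open Summit.Parity.GeneralizedHardyLittlewood.Cruxes.RelativeDimOne.GallagherBackwardsSplit

namespace Summit.Parity.GeneralizedHardyLittlewood.Cruxes.RelativeDimOne.TypeSplit

variable {t : ℕ}

/-! ### Hardy–Littlewood weights -/

/-- The local weight at a prime `p` of the system `(a_i n + b_i)_i`: `|β_p − 1| + t²/p²` (the size of the
Hardy–Littlewood deviation, with `p⁻²` slack at generic primes). -/
def wt (a b : Fin t → ℤ) (p : ℕ) : ℝ :=
  |localFactor (sys a b) p - 1| + (t : ℝ) ^ 2 / (p : ℝ) ^ 2

/-- The multiplicative weight of a (squarefree) modulus: `∏_{p ∣ q} (|β_p − 1| + t²/p²)`. -/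
def wprod (q : ℕ) (a b : Fin t → ℤ) : ℝ :=
  ∏ p ∈ q.primeFactors, wt a b p

/-- The smooth scale `G_w(a,b) = ∏_{p ≤ w} (1 + |β_p − 1| + t²/p²)` — the total weight of the `w`-smooth squarefree
moduli at the target; `≍` the local singular factor `∏_{p ≤ w} β_p` for non-degenerate targets. -/
def gscale (w : ℕ) (a b : Fin t → ℤ) : ℝ :=
  ∏ p ∈ Nat.primesLE w, (1 + wt a b p)

/-- The explicit (truncated) singular-series spectrum: `hlCoeff q a b = ∏_{p ∣ q} (β_p(a,b) − 1)`. -/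
def hlCoeff (q : ℕ) (a b : Fin t → ℤ) : ℝ :=
  ∏ p ∈ q.primeFactors, (localFactor (sys a b) p - 1)

/-- `hlCoeff 1 a b = 1` (empty product) — the registered sub-goal under which this vocabulary file lands. -/
theorem hlCoeff_one : ∀ {t : ℕ} (a b : Fin t → ℤ), hlCoeff 1 a b = 1 := by
  intro t a b
  simp [hlCoeff]

/-! ### Spectra as type-invariant functions of the shifts -/

/-- A level spectrum at fixed coefficient vector `a`, `e q b`, is TYPE-INVARIANT: for squarefree `q` it sees the shift
vector `b` only through its incidence types `incType p a b` at the primes `p ∣ q`. -/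
def TypeInvariant (a : Fin t → ℤ) (e : ℕ → (Fin t → ℤ) → ℝ) : Prop :=
  ∀ q : ℕ, Squarefree q → ∀ b b' : Fin t → ℤ,
    (∀ p ∈ q.primeFactors, incType p a b = incType p a b') → e q b = e q b'

/-- HARDY–LITTLEWOOD DECAY with constant `C`: `|e q b| ≤ C ∏_{p ∣ q} (|β_p(a,b) − 1| + t²/p²)` for squarefree `q`. -/
def HasDecay (C : ℝ) (a : Fin t → ℤ) (e : ℕ → (Fin t → ℤ) → ℝ) : Prop :=
  ∀ q : ℕ, Squarefree q → ∀ b : Fin t → ℤ, |e q b| ≤ C * wprod q a b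

/-- The squarefree band sum `Σ_{q ≤ Q, q squarefree} e(q, b)`. -/
def sfBand (Q : ℕ) (e : ℕ → (Fin t → ℤ) → ℝ) (b : Fin t → ℤ) : ℝ :=
  ∑ q ∈ (Finset.Icc 1 Q).filter Squarefree, e q b

/-- The `w`-smooth part of the band sum: squarefree `q ≤ Q` all of whose prime factors are `≤ w`. -/
def smoothBand (Q w : ℕ) (e : ℕ → (Fin t → ℤ) → ℝ) (b : Fin t → ℤ) : ℝ :=
  ∑ q ∈ ((Finset.Icc 1 Q).filter Squarefree).filter (fun q => ∀ p ∈ q.primeFactors, p ≤ w), e q b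

/-! ### Type cells and conditional averages -/

/-- The TYPE CELL of the target `b₀` modulo `q`, conditioned up to `w`: residue vectors `v ∈ [0, q)^t` whose incidence
types agree with those of `b₀` at every prime `p ∣ q` with `p ≤ w` (no condition at the primes `p ∣ q`, `p > w`).
With `w ≥ q` this is the full type class of `b₀ mod q`. It always contains `b₀ mod q`. -/
def typeCell (q w : ℕ) (a b₀ : Fin t → ℤ) : Finset (Fin t → ℕ) :=
  (Fintype.piFinset fun _ : Fin t => Finset.range q).filter
    (fun v => ∀ p ∈ q.primeFactors, p ≤ w → incType p a (fun i => (v i : ℤ)) = incType p a b₀)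

/-- The conditional average of `g` over the type cell: `(Σ_{v ∈ cell} g(v)) / #cell`. -/
def condAvg (q w : ℕ) (a b₀ : Fin t → ℤ) (g : (Fin t → ℤ) → ℝ) : ℝ :=
  (∑ v ∈ typeCell q w a b₀, g (fun i => (v i : ℤ))) / ((typeCell q w a b₀).card : ℝ)

/-- The TYPE-CONDITIONED DENSITY of the band sum at the target: `Σ_{q ≤ Q sqfree} condAvg_q(e q)` — the density
average of `sfBand Q e` over the shifts whose incidence types agree with `b₀`'s at all primes `≤ w`. -/
def condSum (Q w : ℕ) (a b₀ : Fin t → ℤ) (e : ℕ → (Fin t → ℤ) → ℝ) : ℝ :=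
  ∑ q ∈ (Finset.Icc 1 Q).filter Squarefree, condAvg q w a b₀ (e q)

/-- The number of pairs `(n, c)`, `n < W`, `c` in the full type class of `b₀ mod q`, with every `a_i n + c_i` coprime
to `q` (the main-term count of the type-class moving moments). -/
def coprimePairs (q : ℕ) (a b₀ : Fin t → ℤ) (W : ℕ) : ℕ :=
  ∑ n ∈ Finset.range W, ((typeCell q q a b₀).filter (fun c => ∀ i, Int.gcd (a i * n + c i) q = 1)).card

/-- The conditioning height `w = ⌊log₄ N⌋ / D` (so that `∏_{p ≤ w} p ≤ 4^w ≤ N^{1/D}`). -/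
def wlev (D N : ℕ) : ℕ := Nat.log 4 N / D

/-! ### The statements of the reshaped line -/

/-- The core's approximation clause at scale `N`, accuracy `ε`, sizes `≤ L`, for a family of spectra `f a`. -/
def CoreApprox (θ : ℝ) (t L N : ℕ) (ε : ℝ) (f : (Fin t → ℤ) → ℕ → (Fin t → ℤ) → ℝ) : Prop :=
  ∀ Ψ : Fin t → AffLinForm 1, IsNondegenerateSystem Ψ → affLinSize Ψ N ≤ L →
    ∀ K : Set (Fin 1 → ℝ), Convex ℝ K → K ⊆ realBox 1 N →
      |vonMangoldtSum Ψ K N - archFactor Ψ K * sfBand (level θ N) (f (coeffs Ψ)) (consts Ψ)| ≤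
        ε * (archFactor Ψ K * |sfBand (level θ N) (f (coeffs Ψ)) (consts Ψ)| + N)

/-- ATOM P′ — the INCIDENCE-BANDLIMITED CORE WITH HARDY–LITTLEWOOD DECAY at level `N^θ`. For all `t, L` there is
`C` such that for every `ε > 0`, eventually in `N`, SOME family of level-`⌊N^θ⌋` squarefree-supported spectra
`f a : q ↦ (b ↦ f a q b)` — type-invariant and with decay `|f a q b| ≤ C ∏_{p∣q}(|β_p − 1| + t²/p²)` — reproduces
every `S(Ψ, K)` (`Ψ` non-degenerate, `‖Ψ‖_N ≤ L`, `K ⊆ [-N,N]` convex) to relative accuracy `ε (β_∞ |F| + N)`,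
`F = sfBand ⌊N^θ⌋ (f a) b`. Existential in the spectrum; implied by the crux (spectrum `hlCoeff`, `C = 1`). -/
def IncidenceBandlimitedCoreDecay (θ : ℝ) : Prop :=
  ∀ (t L : ℕ), 1 ≤ t → ∃ C : ℝ, 0 < C ∧ ∀ ε : ℝ, 0 < ε → ∃ N₀ : ℕ, ∀ N : ℕ, N₀ ≤ N →
    ∃ f : (Fin t → ℤ) → ℕ → (Fin t → ℤ) → ℝ,
      (∀ a, TypeInvariant a (f a)) ∧ (∀ a, HasDecay C a (f a)) ∧ CoreApprox θ t L N ε f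

/-- TYPE-CLASS MOVING MOMENTS below level `N^{θ₁}` (slack-free). For squarefree `q ≤ N^{θ₁}`, multipliers
`0 < |a_i| ≤ L`, a target `b₀`, windows of length `X_i + 1 ≥ δN` at heights in `[δN, LN]` moving with `n < W`:
summed over the residue vectors `c` of the full TYPE CLASS of `b₀ mod q`,
`Σ_{n<W} Σ_{c} ∏_i (ψ(a_i n+u_i+X_i; q, a_i n+c_i) − ψ(a_i n+u_i−1; q, a_i n+c_i))
   = (∏_i (X_i+1)/φ(q)^t) · coprimePairs + O(ε ∏(X_i+1) (coprimePairs/φ(q)^t + W #class/q^t))`,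
an error RELATIVE to the cell's own main term (plus the trivial `W #class/q^t` for prime powers in non-coprime
classes). From `LowClassSecondMoment θ₁'`, `θ₁' > θ₁` (`stub_typeClassMoments`): expand `ψ = M + g` classwise; after
`c ↦ c + n a` (the class is translation invariant) the completion counts are invariant under unit scaling of the class,
so ONE deviation sums `g` against a function of `gcd(·, q)` = the global PNT error of the window; TWO deviations cost
`‖g‖₂² ≤ ε X²/φ(q)` (class variance at two heights); more cost Brun–Titchmarsh `ψ(window; q, r) ≤ C X/φ(q)`. -/
def TypeClassMoments (θ₁ : ℝ) : Prop :=
  ∀ (t L : ℕ), 1 ≤ t → ∀ δ ε : ℝ, 0 < δ → 0 < ε → ∃ N₀ : ℕ, ∀ N : ℕ, N₀ ≤ N →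
    ∀ q : ℕ, 1 ≤ q → Squarefree q → (q : ℝ) ≤ (N : ℝ) ^ θ₁ →
      ∀ a b₀ u : Fin t → ℤ, (∀ i, a i ≠ 0 ∧ |a i| ≤ L) →
        ∀ X : Fin t → ℕ, (∀ i, δ * N ≤ (X i : ℝ)) →
          ∀ W : ℕ, δ * N ≤ W →
            (∀ i, ∀ n : ℕ, n < W →
              δ * N + 1 ≤ ((a i * n + u i : ℤ) : ℝ) ∧ ((a i * n + u i + X i : ℤ) : ℝ) ≤ L * N) →
            |(∑ n ∈ Finset.range W, ∑ c ∈ typeCell q q a b₀,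
                ∏ i, (classPsi (a i * n + u i + X i).toNat q (resid q (a i * n + c i))
                      - classPsi (a i * n + u i - 1).toNat q (resid q (a i * n + c i))))
              - (∏ i, ((X i : ℝ) + 1)) / (Nat.totient q : ℝ) ^ t * (coprimePairs q a b₀ W : ℝ)|
              ≤ ε * (∏ i, ((X i : ℝ) + 1)) *
                  ((coprimePairs q a b₀ W : ℝ) / (Nat.totient q : ℝ) ^ t
                    + W * ((typeCell q q a b₀).card : ℝ) / (q : ℝ) ^ t)

/-- TYPE RIGIDITY (pure arithmetic of type-invariant decaying spectra; replaces the false `IncidenceRigidity`).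
For a type-invariant spectrum `e` with decay constant `C`, a non-degenerate target `b₀` of height `≤ LN` and the
conditioning height `w = ⌊log₄ N⌋/D`, eventually in `N` and for EVERY level `Q`:
(R1) the band sum at the target is its `w`-smooth part up to `κ G_w`;
(R2) the type-conditioned density `condSum` is the same smooth part up to `κ G_w`;
(R3) the conditioned density of `|e|` is at most `(1+κ) C G_w`.
Hence data `|condSum| ≤ η G_w` force `|sfBand Q e b₀| ≤ (η + 2κ) G_w`. Mechanism (the landed pair case
`pairRigidityWeighted` p112112, now for `t`-tuples): on the cell, `w`-smooth moduli are frozen at the target by type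
invariance; a modulus with a rough part `q₂ ≠ 1` averages freely over `(ℤ/q₂)^t` (CRT) and the mean weight at a rough
prime is `O(t³/p²)`; the dropped part of the band sum is carried by the `k ≤ log|Δ(a,b₀)|/log w` rough primes
dividing the discriminant, worth `exp((4tk + 3t²)/w) − 1 → 0`. -/
def TypeRigidity : Prop :=
  ∀ (t L D : ℕ) (C κ : ℝ), 1 ≤ t → 1 ≤ D → 0 < C → 0 < κ → ∃ N₀ : ℕ, ∀ N : ℕ, N₀ ≤ N →
    ∀ Q : ℕ, ∀ a : Fin t → ℤ, (∀ i, a i ≠ 0 ∧ |a i| ≤ L) →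
      ∀ e : ℕ → (Fin t → ℤ) → ℝ, TypeInvariant a e → HasDecay C a e →
        ∀ b₀ : Fin t → ℤ, (∀ i, |b₀ i| ≤ L * N) → IsNondegenerateSystem (sys a b₀) →
          |sfBand Q e b₀ - smoothBand Q (wlev D N) e b₀| ≤ κ * gscale (wlev D N) a b₀ ∧
          |condSum Q (wlev D N) a b₀ e - smoothBand Q (wlev D N) e b₀| ≤ κ * gscale (wlev D N) a b₀ ∧
          ∑ q ∈ (Finset.Icc 1 Q).filter Squarefree, condAvg q (wlev D N) a b₀ (fun b => |e q b|)
            ≤ (1 + κ) * C * gscale (wlev D N) a b₀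

/-- SINGULAR-SERIES / WEIGHT FACTS (four provable statements about local factors, no primes beyond Chebyshev):
(W1) the smooth scale is dominated by the singular series: `G_w(a,b) ≤ C_t 𝔖(a,b)` for non-degenerate `(a,b)` with
`𝔖 ≠ 0`, uniformly in `w`; (W2) local obstruction: `𝔖(Ψ) = 0` forces `S(Ψ, K) ≤ εN` eventually; (W4) the `w`-smooth
part of the truncated singular-series spectrum at level `N^θ` is `∏_{p ≤ w} β_p` up to `ε` once `w = ⌊log₄N⌋/D`,
`D ≥ D₀(t, L, θ)` (Rankin at `σ = 1`: the missing smooth moduli exceed `N^θ`); (W5) the coprime density on a type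
class is the local factor: `#{c ∈ class : gcd(a_i n + c_i, q) = 1 ∀ i} · q^t = #class · φ(q)^t · ∏_{p∣q} β_p(a, b₀)`
for every shift `n` (translation invariance of the class + CRT). -/
def SingularWeightFacts : Prop :=
  (∀ t : ℕ, 1 ≤ t → ∃ Cw : ℝ, 0 < Cw ∧ ∀ (w : ℕ) (a b : Fin t → ℤ),
      IsNondegenerateSystem (sys a b) → singularProduct (sys a b) ≠ 0 →
        gscale w a b ≤ Cw * singularProduct (sys a b)) ∧
  (∀ (t L : ℕ), 1 ≤ t → ∀ ε : ℝ, 0 < ε → ∃ N₀ : ℕ, ∀ N : ℕ, N₀ ≤ N →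
      ∀ Ψ : Fin t → AffLinForm 1, IsNondegenerateSystem Ψ → affLinSize Ψ N ≤ L → singularProduct Ψ = 0 →
        ∀ K : Set (Fin 1 → ℝ), K ⊆ realBox 1 N → vonMangoldtSum Ψ K N ≤ ε * N) ∧
  (∀ (t L : ℕ) (θ : ℝ), 0 < θ → ∃ D₀ : ℕ, ∀ D : ℕ, D₀ ≤ D → ∀ ε : ℝ, 0 < ε → ∃ N₀ : ℕ, ∀ N : ℕ, N₀ ≤ N →
      ∀ a b : Fin t → ℤ, (∀ i, a i ≠ 0 ∧ |a i| ≤ L) →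
        |smoothBand (level θ N) (wlev D N) (fun q b' => hlCoeff q a b') b
            - singularProductPartial (sys a b) (wlev D N)| ≤ ε) ∧
  (∀ (t q : ℕ), 1 ≤ q → Squarefree q → ∀ a b₀ : Fin t → ℤ, (∀ i, a i ≠ 0) → ∀ n : ℕ,
      ((((typeCell q q a b₀).filter (fun c => ∀ i, Int.gcd (a i * n + c i) q = 1)).card : ℕ) : ℝ) * (q : ℝ) ^ t
        = ((typeCell q q a b₀).card : ℝ) * (Nat.totient q : ℝ) ^ t * localTypeFactor q a b₀)

/-- TYPE DATA (the prime side of the reshaped dictionary): for the core's spectrum `f` at scale `N` (type-invariant,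
decay `C`, reproducing every `S(Ψ,K)` with `‖Ψ‖_N ≤ L₁` to accuracy `ε`), the type-conditioned density of
`sfBand ⌊N^θ⌋ (f a)` at a non-degenerate target `b₀` of height `≤ LN` equals the local singular factor
`∏_{p ≤ w} β_p(a, b₀)`, `w = ⌊log₄N⌋/D`, up to `η G_w(a, b₀)`. From `TypeClassMoments θ₁` + `SingularWeightFacts` (W5)
+ `TypeRigidity` (R3) (`stub_typeData`, any `θ₁ > 0` with `θ + θ₁ < 1`): sum the core clause over the shifts of a box in the type cell of `b₀`
(windows `[0, N)`, heights in `[N, (L+2)N]`, sizes `≤ L₁ = t(2L+2)`), evaluate the prime side by the landed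
`dictionary_identity` summed over the class and `TypeClassMoments` at the modulus `∏_{p ≤ w} p ≤ N^{1/D} ≤ N^{θ₁}`,
and the spectrum side by residue counting modulo `lcm ≤ N^{θ+θ₁} = o(N)` (each `f q` is `q`-periodic and the cell
is `∏_{p≤w}p`-periodic; CRT turns the residue sum into `#cell · condAvg`). -/
def TypeData (θ : ℝ) : Prop :=
  ∀ (t L : ℕ), 1 ≤ t → ∃ D₀ L₁ : ℕ, L ≤ L₁ ∧ ∀ D : ℕ, D₀ ≤ D → ∀ C η : ℝ, 0 < C → 0 < η →
    ∃ ε : ℝ, 0 < ε ∧ ∃ N₀ : ℕ, ∀ N : ℕ, N₀ ≤ N →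
      ∀ f : (Fin t → ℤ) → ℕ → (Fin t → ℤ) → ℝ,
        (∀ a, TypeInvariant a (f a)) → (∀ a, HasDecay C a (f a)) → CoreApprox θ t L₁ N ε f →
        ∀ a b₀ : Fin t → ℤ, (∀ i, a i ≠ 0 ∧ |a i| ≤ L) → (∀ i, |b₀ i| ≤ L * N) →
          IsNondegenerateSystem (sys a b₀) →
          |condSum (level θ N) (wlev D N) a b₀ (f a) - singularProductPartial (sys a b₀) (wlev D N)|
            ≤ η * gscale (wlev D N) a b₀

/-- THE ENDGAME (deduction of the crux from the core at level `θ` and the type data): pick `D` above the thresholds of `TypeData` and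
(W4); for a non-degenerate `Ψ = sys a b₀` with `𝔖(Ψ) = 0` use (W2); otherwise take the core's spectrum `f` at scale
`N`, put `e = f a − hlCoeff · a`: type-invariant, decay `C + 1`; `TypeData` + (R2 for `hlCoeff`) + (W4) bound
`|condSum e| ≤ 3κ G_w`, `TypeRigidity` (R1, R2) gives `|sfBand (f a) b₀ − sfBand (hl a) b₀| ≤ 5κ G_w ≤ 5κ C_t 𝔖(Ψ)`
(W1), the landed uniform Euler tail `abs_sub_sum_squarefree_le` gives `|𝔖(Ψ) − sfBand (hl a) b₀| ≤ ε`, and the core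
clause at `(Ψ, K)` closes `|S − β_∞ 𝔖| ≤ ε₀ (β_∞ 𝔖 + N)` (`β_∞ ≤ 2N`). No translation or interior bookkeeping: the
data are available at EVERY target. -/
def Endgame (θ : ℝ) : Prop :=
  IncidenceBandlimitedCoreDecay θ → TypeData θ → TypeRigidity → SingularWeightFacts → RelativeDimOne

end Summit.Parity.GeneralizedHardyLittlewood.Cruxes.RelativeDimOne.TypeSplit

end
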